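import Mathlib.AlgebraicGeometry.IdealSheaf.Functorial
import Mathlib.AlgebraicGeometry.Morphisms.QuasiSeparated
import Mathlib.RingTheory.Localization.Finiteness
import HarnessLib

/-!
# Extending quasi-coherent ideal sheaves of finite type from a quasi-compact open
# (Stacks 01PD, 01PF, 01PG for sheaves of ideals)

Topic: `Literature/AlgebraicGeometry/Limits` (EGA I (1971) §6.9; The Stacks Project, Properties of
Schemes, §28.22 "Extending quasi-coherent sheaves"). In the language of Mathlib's quasi-coherent
ideal sheaves (`Scheme.IdealSheafData`: an ideal `𝓘(U) ⊆ Γ(X, U)` for every affine open `U`,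
compatible with localisation), an ideal sheaf `𝓘` is *of finite type* when every `𝓘(U)` is
finitely generated (`∀ U : X.affineOpens, (𝓘.ideal U).FG`, the form used throughout
`Literature/AlgebraicGeometry/Resolution`). We prove, for a quasi-coherent sheaf of ideals `𝓕`
on `X`, a quasi-compact open `U ⊆ X` and an ideal sheaf `𝓗` whose restriction to `U` is of
finite type and contained in `𝓕|_U`:

* `exists_fg_le_ideal_eq_of_isAffine` — **Stacks 01PD for ideals, `X` affine**: there is an
  ideal sheaf `𝓖 ⊆ 𝓕` of finite type on `X` with `𝓖|_U = 𝓗|_U`. Printed proof (01PD): take the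
  sections of `𝓕` whose restriction to `U` lies in `𝓗|_U`, a quasi-coherent subsheaf, write it
  as the union of its finitely generated submodules and use quasi-compactness of `U`. Here,
  concretely: `U = ⋃ₖ D(fₖ)`; each generator `y = x / fₖᵐ` of `𝓗(D(fₖ))` gives the global section
  `fₖᴺ x`, which for `N ≫ 0` lies in `𝓕(X)` and restricts into `𝓗(D(fⱼ))` for every `j`; the
  finitely many `fₖᴺ x` generate `𝓖`.
* `exists_fg_le_ideal_eq` — **Stacks 01PF for ideals, `X` quasi-compact and quasi-separated**:
  the same conclusion. Printed proof: induction over a finite affine open cover, extending across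
  one affine open `V` at a time by the affine case applied to `U ∩ V ⊆ V` (quasi-compact since
  `X` is quasi-separated) and gluing; the gluing of `𝓗|_U` with the extension `𝓖_V` on `V` is
  realised inside `X` as `(𝓗|_U)_* ⊓ (𝓖_V)_*` (push-forwards along the two open immersions,
  `Scheme.IdealSheafData.map`), whose restrictions to `U` and `V` are `𝓗|_U` and `𝓖_V`.
* `eq_sSup_fgBelow` — **Stacks 01PG for ideals**: on a quasi-compact quasi-separated scheme every
  quasi-coherent sheaf of ideals is the (directed) supremum of its sub-ideal-sheaves of finite
  type (`fgBelow`, `directedOn_fgBelow`); `exists_le_of_fg_of_le_sSup` — an ideal sheaf of finite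
  type on a quasi-compact scheme is a compact element: if it lies below a directed supremum it lies
  below a member; `exists_fg_le_comap_ι_eq` — 01PF in terms of the restriction `𝓖.comap U.ι`.

Supporting lemmas: ideals of `𝓘` on the affine opens `W ⊆ U` versus the restriction
`𝓘.comap U.ι` (`ideal_eq_of_comap_ι_eq`, `comap_ι_eq_of_forall_ideal_eq`, …); finite
generation and inequalities of ideal sheaves are local (`fg_ideal_of_le_iSup`,
`ideal_le_ideal_of_le_iSup`, via `Ideal.fg_of_localizationSpan`); restriction of a push-forward
along an open immersion (`comap_map_of_isOpenImmersion`, `map_morphismRestrict_eq_comap_ι`).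

These are the extension lemmas behind "`U`-admissible blowing ups form a cofiltered system"
(Stacks 080K–080L) and the finite type refinement of "composition of blowing ups is a blowing up"
(Stacks 080B), see `Literature/AlgebraicGeometry/Resolution/BlowupsCompositionFiniteType.lean`.

## References

* The Stacks Project, Tag 01PD (`properties-lemma-extend-trivial`), Tag 01PF
  (`properties-lemma-extend`), Tag 01PG (`properties-lemma-quasi-coherent-colimit-finite-type`),
  §28.22. [StacksProject]
* A. Grothendieck, J. Dieudonné, EGA I (Springer 1971), Thm. 6.9.7, Cor. 6.9.9.
* U. Görtz, T. Wedhorn, *Algebraic Geometry I*, 2nd ed. (2020), Cor. 10.50 (p. 303) (extension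
  of quasi-coherent submodules of finite type). [GortzWedhorn2020]
-/

noncomputable section

universe u

open CategoryTheory CategoryTheory.Limits AlgebraicGeometry TopologicalSpace

namespace Literature.AlgebraicGeometry.Limits

open Scheme.IdealSheafData

variable {X : Scheme.{u}}

/-! ## Transport between the affine opens of `U` and the affine opens `W ⊆ U` of `X` -/

section Transport

/-- Finite generation of ideals transports along bijective ring maps (the preimage under a
bijection is the image under its inverse). [folklore] -/
theorem fg_comap_of_bijective {A B : Type*} [CommRing A] [CommRing B] (f : A →+* B)
    (hf : Function.Bijective f) {J : Ideal B} (hJ : J.FG) : (J.comap f).FG := by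
  let e := RingEquiv.ofBijective f hf
  have he : J.comap f = J.map (e.symm : B →+* A) := by
    have h1 : J.map (e.symm : B →+* A) = J.map e.symm := rfl
    rw [h1, Ideal.map_symm]
    ext x
    simp only [Ideal.mem_comap]
    rfl
  rw [he]
  exact hJ.map _

/-- Preimages of ideals along a surjective ring map are equal iff the ideals are. [folklore] -/
theorem comap_injective_of_iso {A B : CommRingCat.{u}} (i : A ≅ B) :
    Function.Injective (Ideal.comap i.hom.hom) :=
  Ideal.comap_injective_of_surjective _ i.commRingCatIsoToRingEquiv.surjective

/-- The affine open `U.ι ⁻¹ W` of the open subscheme `U`, for an affine open `W ⊆ U` of `X`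
(Mathlib's `affineOpensRestrict`). [folklore] -/
abbrev preimageAffineOpens (U : X.Opens) (W : X.affineOpens) (hW : (W : X.Opens) ≤ U) :
    (U : Scheme.{u}).affineOpens :=
  (affineOpensRestrict U).symm ⟨W, hW⟩

/-- The affine open `U.ι(W')` of `X`, for an affine open `W'` of the open subscheme `U` (the form
in which it appears in Mathlib's `ideal_comap_of_isOpenImmersion`). [folklore] -/
abbrev imageAffineOpens (U : X.Opens) (W' : (U : Scheme.{u}).affineOpens) : X.affineOpens :=
  ⟨U.ι ''ᵁ (W' : (U : Scheme.{u}).Opens), W'.2.image_of_isOpenImmersion U.ι⟩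

/-- `U.ι(W') ⊆ U`. [folklore] -/
theorem imageAffineOpens_le (U : X.Opens) (W' : (U : Scheme.{u}).affineOpens) :
    (imageAffineOpens U W' : X.Opens) ≤ U :=
  U.ι_image_le _

/-- `U.ι (U.ι ⁻¹ W) = W` for `W ⊆ U`, as affine opens of `X`. [folklore] -/
theorem imageAffineOpens_preimageAffineOpens (U : X.Opens) (W : X.affineOpens)
    (hW : (W : X.Opens) ≤ U) : imageAffineOpens U (preimageAffineOpens U W hW) = W :=
  Subtype.ext (by
    change U.ι ''ᵁ (U.ι ⁻¹ᵁ (W : X.Opens)) = W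
    rw [Scheme.Hom.image_preimage_eq_opensRange_inf, Scheme.Opens.opensRange_ι,
      inf_eq_right.mpr hW])

/-- Two ideal sheaves with the same restriction to `U` have the same section ideals on every
affine open `W ⊆ U` (the section ideal of `𝓘|_U = 𝓘.comap U.ι` on `U.ι ⁻¹ W` is `𝓘(W)` up to
`Γ(U, U.ι ⁻¹ W) ≅ Γ(X, W)`, Mathlib's `ideal_comap_of_isOpenImmersion`). [folklore] -/
theorem ideal_eq_of_comap_ι_eq {I J : X.IdealSheafData} {U : X.Opens}
    (h : I.comap U.ι = J.comap U.ι) (W : X.affineOpens) (hW : (W : X.Opens) ≤ U) :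
    I.ideal W = J.ideal W := by
  have key : (I.comap U.ι).ideal (preimageAffineOpens U W hW) =
      (J.comap U.ι).ideal (preimageAffineOpens U W hW) := by rw [h]
  rw [ideal_comap_of_isOpenImmersion, ideal_comap_of_isOpenImmersion] at key
  have key' := comap_injective_of_iso _ key
  rw [← imageAffineOpens_preimageAffineOpens U W hW]
  exact key'

/-- An inequality of restrictions to `U` gives the inequality of section ideals on every affine
open `W ⊆ U`. [folklore] -/
theorem ideal_le_of_comap_ι_le {I J : X.IdealSheafData} {U : X.Opens}
    (h : I.comap U.ι ≤ J.comap U.ι) (W : X.affineOpens) (hW : (W : X.Opens) ≤ U) :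
    I.ideal W ≤ J.ideal W := by
  have key : (I.comap U.ι).ideal (preimageAffineOpens U W hW) ≤
      (J.comap U.ι).ideal (preimageAffineOpens U W hW) := h _
  rw [ideal_comap_of_isOpenImmersion, ideal_comap_of_isOpenImmersion] at key
  have key' := (Ideal.comap_le_comap_iff_of_surjective _
    (U.ι.appIso _).symm.commRingCatIsoToRingEquiv.surjective _ _).mp key
  rw [← imageAffineOpens_preimageAffineOpens U W hW]
  exact key'

/-- Conversely, ideal sheaves agreeing on every affine open `W ⊆ U` have the same restriction to
`U` (the affine opens of `U` are the `U.ι ⁻¹ W`). [folklore] -/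
theorem comap_ι_eq_of_forall_ideal_eq {I J : X.IdealSheafData} {U : X.Opens}
    (h : ∀ W : X.affineOpens, (W : X.Opens) ≤ U → I.ideal W = J.ideal W) :
    I.comap U.ι = J.comap U.ι := by
  refine Scheme.IdealSheafData.ext (funext fun W' => ?_)
  rw [ideal_comap_of_isOpenImmersion, ideal_comap_of_isOpenImmersion,
    h (imageAffineOpens U W') (imageAffineOpens_le U W')]

/-- And inequalities on every affine open `W ⊆ U` give the inequality of restrictions. [folklore] -/
theorem comap_ι_le_of_forall_ideal_le {I J : X.IdealSheafData} {U : X.Opens}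
    (h : ∀ W : X.affineOpens, (W : X.Opens) ≤ U → I.ideal W ≤ J.ideal W) :
    I.comap U.ι ≤ J.comap U.ι := fun W' => by
  rw [ideal_comap_of_isOpenImmersion, ideal_comap_of_isOpenImmersion]
  exact Ideal.comap_mono (h (imageAffineOpens U W') (imageAffineOpens_le U W'))

/-- The restriction to `U` of an ideal sheaf whose section ideals on the affine opens `W ⊆ U`
are finitely generated is of finite type. [folklore] -/
theorem fg_ideal_comap_ι {I : X.IdealSheafData} {U : X.Opens}
    (h : ∀ W : X.affineOpens, (W : X.Opens) ≤ U → (I.ideal W).FG)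
    (W' : (U : Scheme.{u}).affineOpens) : ((I.comap U.ι).ideal W').FG := by
  rw [ideal_comap_of_isOpenImmersion]
  exact fg_comap_of_bijective _ (ConcreteCategory.bijective_of_isIso (U.ι.appIso _).inv)
    (h (imageAffineOpens U W') (imageAffineOpens_le U W'))

/-- Conversely, if `𝓘|_U` is of finite type then `𝓘(W)` is finitely generated for every affine
open `W ⊆ U`. [folklore] -/
theorem fg_ideal_of_fg_ideal_comap_ι {I : X.IdealSheafData} {U : X.Opens}
    (h : ∀ W' : (U : Scheme.{u}).affineOpens, ((I.comap U.ι).ideal W').FG)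
    (W : X.affineOpens) (hW : (W : X.Opens) ≤ U) : (I.ideal W).FG := by
  have key := h (preimageAffineOpens U W hW)
  rw [ideal_comap_of_isOpenImmersion] at key
  have key' := key.map (U.ι.appIso (preimageAffineOpens U W hW : (U : Scheme.{u}).Opens)).inv.hom
  rw [Ideal.map_comap_of_surjective _
    (ConcreteCategory.bijective_of_isIso
      (U.ι.appIso (preimageAffineOpens U W hW : (U : Scheme.{u}).Opens)).inv).2] at key'
  rw [← imageAffineOpens_preimageAffineOpens U W hW]
  exact key'

end Transport

/-! ## Finite generation and inequalities of ideal sheaves are local -/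

section Local

/-- On an affine open `W`, the section ideal `𝓘(D(g))` of a basic open is the extension of `𝓘(W)`
to the localisation `Γ(X, D(g)) = Γ(X, W)[1/g]`. [folklore] -/
theorem ideal_affineBasicOpen_eq_map (I : X.IdealSheafData) (W : X.affineOpens) (g : Γ(X, W)) :
    I.ideal (X.affineBasicOpen g) = (I.ideal W).map (algebraMap Γ(X, W) Γ(X, X.basicOpen g)) :=
  (I.map_ideal (X.affineBasicOpen_le g)).symm

/-- The sections `g ∈ Γ(X, W)` of an affine open `W ⊆ ⋃ V i` whose basic opens `D(g)` lie in
some `V i` generate the unit ideal (they cover `W`). [folklore] -/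
theorem span_setOf_basicOpen_le_eq_top (W : X.affineOpens) {ι : Type*} (V : ι → X.Opens)
    (hW : (W : X.Opens) ≤ ⨆ i, V i) :
    Ideal.span {g : Γ(X, W) | ∃ i, X.basicOpen g ≤ V i} = ⊤ := by
  rw [← W.2.iSup_basicOpen_eq_self_iff]
  refine le_antisymm (iSup_le fun g => X.basicOpen_le _) fun x hx => ?_
  obtain ⟨i, hi⟩ := Opens.mem_iSup.mp (hW hx)
  obtain ⟨g, hgV, hxg⟩ := W.2.exists_basicOpen_le ⟨x, hi⟩ hx
  exact Opens.mem_iSup.mpr ⟨⟨g, i, hgV⟩, hxg⟩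

/-- **Finite generation of the section ideals of an ideal sheaf is local**: if `𝓘(W')` is finitely
generated for every affine open `W'` contained in some member of a family of opens `V i`, then
`𝓘(W)` is finitely generated for every affine open `W ⊆ ⋃ V i` (cover `W` by basic opens `D(g)`
inside the `V i`; the `g` generate the unit ideal and `𝓘(D(g)) = 𝓘(W)[1/g]`, so
`Ideal.fg_of_localizationSpan` applies). [folklore] -/
theorem fg_ideal_of_le_iSup (I : X.IdealSheafData) {ι : Type*} (V : ι → X.Opens)
    (h : ∀ i (W' : X.affineOpens), (W' : X.Opens) ≤ V i → (I.ideal W').FG)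
    (W : X.affineOpens) (hW : (W : X.Opens) ≤ ⨆ i, V i) : (I.ideal W).FG := by
  refine Ideal.fg_of_localizationSpan {g : Γ(X, W) | ∃ i, X.basicOpen g ≤ V i}
    (span_setOf_basicOpen_le_eq_top W V hW) fun g => ?_
  obtain ⟨i, hi⟩ : ∃ i, X.basicOpen (g : Γ(X, W)) ≤ V i := g.2
  -- `𝓘(W)[1/g] ≅ 𝓘(D(g))`, finitely generated by hypothesis
  haveI := W.2.isLocalization_basicOpen (g : Γ(X, W))
  let e : Localization.Away (g : Γ(X, W)) ≃ₐ[Γ(X, W)] Γ(X, X.basicOpen (g : Γ(X, W))) :=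
    IsLocalization.algEquiv (Submonoid.powers (g : Γ(X, W))) _ _
  have key : (I.ideal W).map (algebraMap Γ(X, W) (Localization.Away (g : Γ(X, W)))) =
      ((I.ideal W).map (algebraMap Γ(X, W) Γ(X, X.basicOpen (g : Γ(X, W))))).map
        (e.symm : Γ(X, X.basicOpen (g : Γ(X, W))) →+* Localization.Away (g : Γ(X, W))) := by
    rw [Ideal.map_map]
    congr 1
    ext x
    exact (e.symm.commutes x).symm
  rw [key, ← ideal_affineBasicOpen_eq_map]
  exact (h i (X.affineBasicOpen (g : Γ(X, W))) hi).map _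

/-- **Inequalities of ideal sheaves are local**: if `𝓘(W') ≤ 𝓙(W')` for every affine open `W'`
inside some `V i`, then `𝓘(W) ≤ 𝓙(W)` for every affine open `W ⊆ ⋃ V i` (an element lying in
`𝓙(W)[1/g]` for a family of `g` generating the unit ideal lies in `𝓙(W)`). [folklore] -/
theorem ideal_le_ideal_of_le_iSup (I J : X.IdealSheafData) {ι : Type*} (V : ι → X.Opens)
    (h : ∀ i (W' : X.affineOpens), (W' : X.Opens) ≤ V i → I.ideal W' ≤ J.ideal W')
    (W : X.affineOpens) (hW : (W : X.Opens) ≤ ⨆ i, V i) : I.ideal W ≤ J.ideal W := by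
  intro x hx
  refine Submodule.mem_of_span_eq_top_of_smul_pow_mem _ {g : Γ(X, W) | ∃ i, X.basicOpen g ≤ V i}
    (span_setOf_basicOpen_le_eq_top W V hW) x fun g => ?_
  obtain ⟨i, hi⟩ : ∃ i, X.basicOpen (g : Γ(X, W)) ≤ V i := g.2
  haveI := W.2.isLocalization_basicOpen (g : Γ(X, W))
  -- `x|_{D(g)} ∈ 𝓘(D(g)) ≤ 𝓙(D(g)) = 𝓙(W)[1/g]`
  have h1 : algebraMap Γ(X, W) Γ(X, X.basicOpen (g : Γ(X, W))) x ∈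
      (J.ideal W).map (algebraMap Γ(X, W) Γ(X, X.basicOpen (g : Γ(X, W)))) := by
    rw [← ideal_affineBasicOpen_eq_map]
    refine h i (X.affineBasicOpen (g : Γ(X, W))) hi ?_
    rw [ideal_affineBasicOpen_eq_map]
    exact Ideal.mem_map_of_mem _ hx
  obtain ⟨⟨z, ⟨_, n, rfl⟩⟩, hz⟩ :=
    (IsLocalization.mem_map_algebraMap_iff (.powers (g : Γ(X, W))) _).mp h1
  -- `g^n x = z` up to a power of `g`
  have h2 : algebraMap Γ(X, W) Γ(X, X.basicOpen (g : Γ(X, W))) (x * (g : Γ(X, W)) ^ n - z) = 0 := by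
    rw [map_sub, map_mul, sub_eq_zero]
    exact hz
  obtain ⟨⟨_, m, rfl⟩, hm⟩ := (IsLocalization.map_eq_zero_iff (.powers (g : Γ(X, W))) _ _).mp h2
  refine ⟨m + n, ?_⟩
  have : (g : Γ(X, W)) ^ (m + n) • x = (g : Γ(X, W)) ^ m * z := by
    rw [mul_sub, sub_eq_zero] at hm
    rw [smul_eq_mul, pow_add, mul_assoc, mul_comm _ x, hm]
  rw [this]
  exact Ideal.mul_mem_left _ _ z.2

end Local

/-- Equality of restrictions to `U` can be tested on affine opens `D i ⊆ U` of `X` covering `U`.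
[folklore] -/
theorem comap_ι_eq_of_forall_ideal_eq_of_iSup {I J : X.IdealSheafData} {U : X.Opens} {ι : Type*}
    (D : ι → X.affineOpens) (hDU : ∀ i, (D i : X.Opens) ≤ U) (hUD : U ≤ ⨆ i, (D i : X.Opens))
    (h : ∀ i, I.ideal (D i) = J.ideal (D i)) : I.comap U.ι = J.comap U.ι := by
  refine Scheme.IdealSheafData.ext_of_iSup_eq_top (fun i => preimageAffineOpens U (D i) (hDU i))
    ?_ fun i => ?_
  · refine top_le_iff.mp ?_
    rw [← Scheme.Opens.ι_preimage_self (U := U)]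
    intro x hx
    have hx' : (U.ι x) ∈ ⨆ i, (D i : X.Opens) := hUD hx
    obtain ⟨i, hi⟩ := Opens.mem_iSup.mp hx'
    exact Opens.mem_iSup.mpr ⟨i, hi⟩
  · have hi := h i
    rw [← imageAffineOpens_preimageAffineOpens U (D i) (hDU i)] at hi
    rw [ideal_comap_of_isOpenImmersion, ideal_comap_of_isOpenImmersion]
    exact congrArg (Ideal.comap _) hi

/-! ## Push-forward of ideal sheaves along open immersions -/

section OpenImmersion

/-- The inclusion of a quasi-compact open of a quasi-separated scheme is a quasi-compact
morphism. [folklore] -/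
theorem quasiCompact_ι_of_isCompact [QuasiSeparatedSpace X] (U : X.Opens)
    (hU : IsCompact (U : Set X)) : QuasiCompact U.ι := by
  refine ⟨fun V hVo hVc => ?_⟩
  rw [U.ι.isOpenEmbedding.isInducing.isCompact_iff, Set.image_preimage_eq_inter_range,
    Scheme.Opens.range_ι]
  exact QuasiSeparatedSpace.inter_isCompact _ _ hVo hVc U.2 hU

/-- **Restricting the push-forward along a quasi-compact open immersion gives the ideal sheaf
back**: `(f_* 𝓘 ∩ 𝒪_Y)|_X = 𝓘` for `f : X → Y` an open immersion (`V(𝓘) → X` is the base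
change of `V(𝓘) → X → Y` along the monomorphism `f`). [folklore] -/
theorem comap_map_of_isOpenImmersion {X Y : Scheme.{u}} (f : X ⟶ Y) [IsOpenImmersion f]
    [QuasiCompact f] (I : X.IdealSheafData) : (I.map f).comap f = I := by
  refine Scheme.IdealSheafData.ext (funext fun W => ?_)
  have H : IsPullback (I.subschemeι ≫ 𝟙 X) (𝟙 _) f (I.subschemeι ≫ f) :=
    IsPullback.of_id_snd.paste_horiz (IsKernelPair.id_of_mono f)
  rw [Category.comp_id] at H
  have key := Scheme.ker_ideal_of_isPullback_of_isOpenImmersion (I.subschemeι ≫ f) I.subschemeι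
    (𝟙 _) f H W
  rw [ker_subschemeι] at key
  rw [ideal_comap_of_isOpenImmersion]
  exact key.symm

/-- **Push-forward of ideal sheaves commutes with restriction to an open of the target**: for
`f : X → Y` quasi-compact, an ideal sheaf `𝓘` on `X` and an open `U ⊆ Y`,
`(f|_U)_*(𝓘|_{f⁻¹U}) ∩ 𝒪_U = (f_*𝓘 ∩ 𝒪_Y)|_U` (kernels of quasi-compact morphisms commute with
restriction to opens, Mathlib's `ker_ideal_of_isPullback_of_isOpenImmersion`; the same statement
as `Literature.AlgebraicGeometry.Resolution.map_morphismRestrict_eq_comap` of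
`BlowupsComposition.lean`, repeated here to keep this file independent of the blow-up files).
[folklore] -/
theorem map_morphismRestrict_eq_comap_ι {X Y : Scheme.{u}} (f : X ⟶ Y) [QuasiCompact f]
    (I : X.IdealSheafData) (U : Y.Opens) :
    (I.comap (f ⁻¹ᵁ U).ι).map (f ∣_ U) = (I.map f).comap U.ι := by
  let iU : (I.comap (f ⁻¹ᵁ U).ι).subscheme ⟶ I.subscheme :=
    (I.comapIso (f ⁻¹ᵁ U).ι).hom ≫ pullback.snd _ _
  have sqA : IsPullback (I.comap (f ⁻¹ᵁ U).ι).subschemeι iU (f ⁻¹ᵁ U).ι I.subschemeι :=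
    IsPullback.of_iso_pullback ⟨by simp [iU]⟩ (I.comapIso (f ⁻¹ᵁ U).ι)
      (by simp) (by simp [iU])
  have H : IsPullback ((I.comap (f ⁻¹ᵁ U).ι).subschemeι ≫ f ∣_ U) iU U.ι (I.subschemeι ≫ f) :=
    sqA.paste_horiz (isPullback_morphismRestrict f U)
  apply Scheme.IdealSheafData.ext
  funext W
  change ((I.comap (f ⁻¹ᵁ U).ι).subschemeι ≫ f ∣_ U).ker.ideal W = _
  rw [Scheme.IdealSheafData.ideal_comap_of_isOpenImmersion,
    Scheme.ker_ideal_of_isPullback_of_isOpenImmersion (I.subschemeι ≫ f) _ iU U.ι H W]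
  rfl

/-- Restriction along an open immersion preserves intersections of ideal sheaves (the section
ideals of `𝓘.comap f` are those of `𝓘` on the images). [folklore] -/
theorem comap_inf_of_isOpenImmersion {X Y : Scheme.{u}} (f : X ⟶ Y) [IsOpenImmersion f]
    (I J : Y.IdealSheafData) : (I ⊓ J).comap f = I.comap f ⊓ J.comap f := by
  refine Scheme.IdealSheafData.ext (funext fun W => ?_)
  change _ = (I.comap f).ideal W ⊓ (J.comap f).ideal W
  rw [ideal_comap_of_isOpenImmersion, ideal_comap_of_isOpenImmersion,
    ideal_comap_of_isOpenImmersion, ← Ideal.comap_inf]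
  rfl

end OpenImmersion

/-! ## Two denominators-clearing lemmas -/

section Algebra

open Filter

/-- In a localisation `B = R[1/f]`: if `y ∈ J B` and `y fᵐ = x`, then `fⁿ x ∈ J` for all large
`n`. [folklore] -/
theorem eventually_pow_mul_mem {R B : Type*} [CommRing R] [CommRing B] [Algebra R B] (f : R)
    [IsLocalization.Away f B] (J : Ideal R) {y : B} (hy : y ∈ J.map (algebraMap R B))
    {m : ℕ} {x : R} (hyx : y * algebraMap R B (f ^ m) = algebraMap R B x) :
    ∀ᶠ n in atTop, f ^ n * x ∈ J := by
  obtain ⟨⟨a, ⟨_, c, rfl⟩⟩, ha⟩ :=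
    (IsLocalization.mem_map_algebraMap_iff (.powers f) B).mp hy
  -- `x f^c = a f^m` up to a power of `f`
  have h1 : algebraMap R B (x * f ^ c) = algebraMap R B (a * f ^ m) := by
    rw [map_mul, map_mul, ← hyx, ← ha]
    ring
  obtain ⟨⟨_, k, rfl⟩, hk⟩ := (IsLocalization.eq_iff_exists (.powers f) B).mp h1
  simp only at hk
  refine eventually_atTop.mpr ⟨k + c, fun n hn => ?_⟩
  have e : f ^ n * x = f ^ (n - (k + c)) * (f ^ k * (x * f ^ c)) := by
    rw [show f ^ k * (x * f ^ c) = f ^ (k + c) * x by ring, ← mul_assoc, ← pow_add]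
    congr 2
    omega
  rw [e, hk]
  exact Ideal.mul_mem_left _ _ (Ideal.mul_mem_left _ _ (Ideal.mul_mem_right _ _ a.2))

/-- For ring maps `R → B' → C` with `C = B'[1/f]` (`f` coming from `R`) and an ideal `K ⊆ B'`:
if `w ∈ K C` and `w fᵐ = x` in `C`, then the image of `fⁿ x` in `B'` lies in `K` for all large
`n`. [folklore] -/
theorem eventually_map_pow_mul_mem {R B' C : Type*} [CommRing R] [CommRing B'] [CommRing C]
    [Algebra B' C] (r : R →+* B') (f : R) [IsLocalization.Away (r f) C] (K : Ideal B') {w : C}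
    (hw : w ∈ K.map (algebraMap B' C)) {m : ℕ} {x : R}
    (hwx : w * algebraMap B' C (r (f ^ m)) = algebraMap B' C (r x)) :
    ∀ᶠ n in atTop, r (f ^ n * x) ∈ K := by
  obtain ⟨⟨z, ⟨_, c, rfl⟩⟩, hz⟩ :=
    (IsLocalization.mem_map_algebraMap_iff (.powers (r f)) C).mp hw
  have h1 : algebraMap B' C (r (x * f ^ c)) = algebraMap B' C (z * r (f ^ m)) := by
    simp only [map_mul, map_pow] at hwx hz ⊢
    rw [← hwx, ← hz]
    ring
  obtain ⟨⟨_, k, rfl⟩, hk⟩ := (IsLocalization.eq_iff_exists (.powers (r f)) C).mp h1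
  simp only at hk
  refine eventually_atTop.mpr ⟨k + c, fun n hn => ?_⟩
  have e : f ^ n * x = f ^ (n - (k + c)) * (f ^ k * (x * f ^ c)) := by
    rw [show f ^ k * (x * f ^ c) = f ^ (k + c) * x by ring, ← mul_assoc, ← pow_add]
    congr 2
    omega
  rw [e, map_mul, map_mul r (f ^ k), map_pow r f k, hk]
  exact Ideal.mul_mem_left _ _ (Ideal.mul_mem_left _ _ (Ideal.mul_mem_right _ _ z.2))

end Algebra

/-! ## The affine case (Stacks 01PD for ideals) -/

section Affine

open Filter

/-- For an affine open `V`, sections `f, f' ∈ Γ(X, V)`, and `y ∈ 𝓗(D(f))` with `y fᵐ = x`,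
`x ∈ Γ(X, V)`: the restriction of `fⁿ x` to `D(f')` lies in `𝓗(D(f'))` for all large `n`
(compare the two on `D(f f') = D(f')[1/f]`, where `y` restricts into `𝓗(D(ff')) = 𝓗(D(f'))[1/f]`).
[folklore] -/
theorem eventually_algebraMap_pow_mul_mem_ideal (H : X.IdealSheafData) (V : X.affineOpens)
    (f f' : Γ(X, V)) {y : Γ(X, X.basicOpen f)} (hy : y ∈ H.ideal (X.affineBasicOpen f))
    {m : ℕ} {x : Γ(X, V)}
    (hmx : y * algebraMap Γ(X, V) Γ(X, X.basicOpen f) (f ^ m) = algebraMap _ _ x) :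
    ∀ᶠ n in atTop, algebraMap Γ(X, V) Γ(X, X.basicOpen f') (f ^ n * x) ∈
      H.ideal (X.affineBasicOpen f') := by
  -- the overlap `D(f f')`, as the basic open of `D(f')` at the restriction `g` of `f`
  haveI : IsLocalization.Away (algebraMap Γ(X, V) Γ(X, X.basicOpen f') f)
      Γ(X, X.basicOpen (algebraMap Γ(X, V) Γ(X, X.basicOpen f') f)) :=
    (X.affineBasicOpen f').2.isLocalization_basicOpen _
  have hWf : X.basicOpen (algebraMap Γ(X, V) Γ(X, X.basicOpen f') f) ≤ X.basicOpen f := by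
    have := X.basicOpen_res f (homOfLE (X.basicOpen_le f')).op
    exact (le_of_eq this).trans inf_le_right
  -- restriction `Γ(D(f)) → Γ(D(ff'))` and its compatibility with the maps from `Γ(X, V)`
  have hρ : ∀ a : Γ(X, V), (X.presheaf.map (homOfLE hWf).op).hom
      (algebraMap Γ(X, V) Γ(X, X.basicOpen f) a) =
        algebraMap Γ(X, X.basicOpen f') Γ(X, X.basicOpen (algebraMap Γ(X, V) Γ(X, X.basicOpen f') f))
          (algebraMap Γ(X, V) Γ(X, X.basicOpen f') a) := by
    intro a
    change (X.presheaf.map _ ≫ X.presheaf.map _) a = (X.presheaf.map _ ≫ X.presheaf.map _) a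
    rw [← Functor.map_comp, ← Functor.map_comp]
    rfl
  have key : (X.presheaf.map (homOfLE hWf).op).hom y *
      algebraMap Γ(X, X.basicOpen f') _ (algebraMap Γ(X, V) Γ(X, X.basicOpen f') (f ^ m)) =
        algebraMap Γ(X, X.basicOpen f') _ (algebraMap Γ(X, V) Γ(X, X.basicOpen f') x) := by
    rw [← hρ, ← hρ, ← hmx, map_mul]
  refine eventually_map_pow_mul_mem (algebraMap Γ(X, V) Γ(X, X.basicOpen f')) f
    (H.ideal (X.affineBasicOpen f')) ?_ key
  have h2 : (X.presheaf.map (homOfLE hWf).op).hom y ∈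
      H.ideal (X.affineBasicOpen (U := X.affineBasicOpen f')
        (algebraMap Γ(X, V) Γ(X, X.basicOpen f') f)) :=
    H.ideal_le_comap_ideal
      (U := X.affineBasicOpen (U := X.affineBasicOpen f') (algebraMap Γ(X, V) Γ(X, X.basicOpen f') f))
      (V := X.affineBasicOpen f) hWf hy
  rw [ideal_affineBasicOpen_eq_map] at h2
  exact h2

/-- For an affine open `V`, `f ∈ Γ(X, V)` and `y ∈ 𝓗(D(f)) ⊆ 𝓕(D(f)) = 𝓕(V)[1/f]` with
`y fᵐ = x`: `fⁿ x ∈ 𝓕(V)` for all large `n`. [folklore] -/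
theorem eventually_pow_mul_mem_ideal (F H : X.IdealSheafData) (V : X.affineOpens) (f : Γ(X, V))
    (hHF : H.ideal (X.affineBasicOpen f) ≤ F.ideal (X.affineBasicOpen f))
    {y : Γ(X, X.basicOpen f)} (hy : y ∈ H.ideal (X.affineBasicOpen f)) {m : ℕ} {x : Γ(X, V)}
    (hmx : y * algebraMap Γ(X, V) Γ(X, X.basicOpen f) (f ^ m) = algebraMap _ _ x) :
    ∀ᶠ n in atTop, f ^ n * x ∈ F.ideal V := by
  haveI := V.2.isLocalization_basicOpen f
  refine eventually_pow_mul_mem f (F.ideal V) ?_ hmx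
  rw [← ideal_affineBasicOpen_eq_map]
  exact hHF hy

/-- An affine scheme as an affine open of itself. [folklore] -/
abbrev topAffineOpens (X : Scheme.{u}) [IsAffine X] : X.affineOpens :=
  ⟨⊤, isAffineOpen_top X⟩

/-- **Stacks 01PD for sheaves of ideals (extension from a quasi-compact open of an affine
scheme).** Let `X` be affine, `U ⊆ X` a quasi-compact open, `𝓕` a quasi-coherent sheaf of ideals
on `X` and `𝓗` an ideal sheaf whose section ideals on the affine opens `W ⊆ U` are finitely
generated and contained in those of `𝓕` (i.e. `𝓗|_U ⊆ 𝓕|_U` is of finite type). Then there is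
an ideal sheaf `𝓖 ⊆ 𝓕` of finite type on `X` with `𝓖|_U = 𝓗|_U` (same section ideals on every
affine open `W ⊆ U`). Stacks: "Let `X` be an affine scheme … Let `U ⊂ X` be a quasi-compact open.
Let `𝓕` be a quasi-coherent `𝒪_X`-module. Let `𝓖 ⊂ 𝓕|_U` be a quasi-coherent `𝒪_U`-submodule
which is of finite type. Then there exists a quasi-coherent submodule `𝓖' ⊂ 𝓕` which is of
finite type such that `𝓖'|_U = 𝓖`", here for `𝓕` a sheaf of ideals. Proof: `U = ⋃ D(fₖ)`
(finitely many); the finitely many generators `y = x / fₖᵐ` of the `𝓗(D(fₖ))` give sections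
`fₖᴺ x ∈ 𝓕(X)` restricting into every `𝓗(D(fⱼ))` for `N ≫ 0`
(`eventually_pow_mul_mem_ideal`, `eventually_algebraMap_pow_mul_mem_ideal`); they generate `𝓖`.
[cite: StacksProject, Tag 01PD] -/
theorem exists_fg_le_ideal_eq_of_isAffine [IsAffine X] (U : X.Opens) (hU : IsCompact (U : Set X))
    (F H : X.IdealSheafData) (hH : ∀ W : X.affineOpens, (W : X.Opens) ≤ U → (H.ideal W).FG)
    (hHF : ∀ W : X.affineOpens, (W : X.Opens) ≤ U → H.ideal W ≤ F.ideal W) :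
    ∃ G : X.IdealSheafData, (∀ W : X.affineOpens, (G.ideal W).FG) ∧ G ≤ F ∧
      ∀ W : X.affineOpens, (W : X.Opens) ≤ U → G.ideal W = H.ideal W := by
  classical
  -- `U` is a finite union of basic opens `D(f)`, `f ∈ s`
  obtain ⟨s, hs, hUs⟩ :=
    (isCompact_and_isOpen_iff_finite_and_eq_biUnion_basicOpen (X := X)).mp ⟨hU, U.isOpen⟩
  haveI : Finite s := hs.to_subtype
  have hDU : ∀ f : s, (X.affineBasicOpen (U := topAffineOpens X) (f : Γ(X, ⊤)) : X.Opens) ≤ U :=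
    fun f => SetLike.coe_subset_coe.mp (by
      rw [hUs]
      exact Set.subset_biUnion_of_mem (u := fun i : Γ(X, ⊤) => (X.basicOpen i : Set X)) f.2)
  have hUD : U ≤ ⨆ f : s, (X.affineBasicOpen (U := topAffineOpens X) (f : Γ(X, ⊤)) : X.Opens) :=
    SetLike.coe_subset_coe.mp (by
      rw [Opens.coe_iSup, hUs, Set.biUnion_eq_iUnion]
      rfl)
  haveI : ∀ f : s, IsLocalization.Away (f : Γ(X, ⊤)) Γ(X, X.basicOpen (f : Γ(X, ⊤))) :=
    fun f => (isAffineOpen_top X).isLocalization_basicOpen _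
  -- finite generating sets of the `𝓗(D(f))`, and numerators of the generators
  have hgen : ∀ f : s, ∃ S : Finset Γ(X, X.basicOpen (f : Γ(X, ⊤))),
      Ideal.span (↑S : Set Γ(X, X.basicOpen (f : Γ(X, ⊤)))) =
        H.ideal (X.affineBasicOpen (U := topAffineOpens X) (f : Γ(X, ⊤))) :=
    fun f => hH _ (hDU f)
  choose S hS using hgen
  have hnum : ∀ (f : s) (y : Γ(X, X.basicOpen (f : Γ(X, ⊤)))), ∃ mx : ℕ × Γ(X, ⊤),
      y * algebraMap Γ(X, ⊤) _ ((f : Γ(X, ⊤)) ^ mx.1) = algebraMap Γ(X, ⊤) _ mx.2 := fun f y => by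
    obtain ⟨⟨x, _, m, rfl⟩, e⟩ := IsLocalization.surj (.powers (f : Γ(X, ⊤))) y
    exact ⟨(m, x), e⟩
  choose mx hmx using hnum
  -- a common exponent `N`
  have hev : ∀ᶠ n in atTop, ∀ f : s, ∀ y ∈ S f,
      (f : Γ(X, ⊤)) ^ n * (mx f y).2 ∈ F.ideal (topAffineOpens X) ∧
        ∀ f' : s, algebraMap Γ(X, ⊤) Γ(X, X.basicOpen (f' : Γ(X, ⊤))) ((f : Γ(X, ⊤)) ^ n * (mx f y).2) ∈
          H.ideal (X.affineBasicOpen (U := topAffineOpens X) (f' : Γ(X, ⊤))) := by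
    refine eventually_all.mpr fun f => (eventually_all_finset (S f)).mpr fun y hy => ?_
    have hy' : y ∈ H.ideal (X.affineBasicOpen (U := topAffineOpens X) (f : Γ(X, ⊤))) :=
      hS f ▸ Ideal.subset_span hy
    refine (eventually_pow_mul_mem_ideal F H (topAffineOpens X) (f : Γ(X, ⊤)) (hHF _ (hDU f)) hy'
      (hmx f y)).and (eventually_all.mpr fun f' => ?_)
    exact eventually_algebraMap_pow_mul_mem_ideal H (topAffineOpens X) (f : Γ(X, ⊤)) (f' : Γ(X, ⊤))
      hy' (hmx f y)
  obtain ⟨N, hN⟩ := hev.exists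
  -- the generators of `𝓖`
  obtain ⟨A, hA⟩ : ∃ A : Set Γ(X, ⊤),
      A = ⋃ f : s, (fun y : Γ(X, X.basicOpen (f : Γ(X, ⊤))) =>
        (f : Γ(X, ⊤)) ^ N * (mx f y).2) '' ↑(S f) := ⟨_, rfl⟩
  have hAfin : A.Finite := by
    rw [hA]
    exact Set.finite_iUnion fun f => (S f).finite_toSet.image _
  have hAF : ∀ a ∈ A, a ∈ F.ideal (topAffineOpens X) := by
    intro a ha
    rw [hA] at ha
    obtain ⟨f, hf⟩ := Set.mem_iUnion.mp ha
    obtain ⟨y, hy, rfl⟩ := hf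
    exact (hN f y hy).1
  have hAH : ∀ a ∈ A, ∀ f' : s, algebraMap Γ(X, ⊤) Γ(X, X.basicOpen (f' : Γ(X, ⊤))) a ∈
      H.ideal (X.affineBasicOpen (U := topAffineOpens X) (f' : Γ(X, ⊤))) := by
    intro a ha f'
    rw [hA] at ha
    obtain ⟨f, hf⟩ := Set.mem_iUnion.mp ha
    obtain ⟨y, hy, rfl⟩ := hf
    exact (hN f y hy).2 f'
  refine ⟨ofIdealTop (Ideal.span A), fun W => ?_, ?_, ?_⟩
  · -- of finite type
    rw [ofIdealTop_ideal]
    have hfg : (Ideal.span A).FG := ⟨hAfin.toFinset, by rw [Set.Finite.coe_toFinset]⟩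
    exact hfg.map _
  · -- contained in `𝓕`
    refine le_of_isAffine ?_
    rw [ofIdealTop_ideal, Ideal.map_le_iff_le_comap, Ideal.span_le]
    intro a ha
    rw [SetLike.mem_coe, Ideal.mem_comap]
    have e : (homOfLE (le_top : ((topAffineOpens X : X.Opens)) ≤ ⊤)).op = 𝟙 _ :=
      Subsingleton.elim _ _
    rw [e, X.presheaf.map_id]
    exact hAF a ha
  · -- equal to `𝓗` on `U`
    refine ideal_eq_of_comap_ι_eq (comap_ι_eq_of_forall_ideal_eq_of_iSup
      (fun f : s => X.affineBasicOpen (U := topAffineOpens X) (f : Γ(X, ⊤))) hDU hUD fun f => ?_)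
    rw [ofIdealTop_ideal]
    change (Ideal.span A).map (algebraMap Γ(X, ⊤) Γ(X, X.basicOpen (f : Γ(X, ⊤)))) = _
    rw [Ideal.map_span]
    apply le_antisymm
    · refine Ideal.span_le.mpr ?_
      rintro _ ⟨a, ha, rfl⟩
      exact hAH a ha f
    · rw [← hS f]
      refine Ideal.span_le.mpr fun y hy => ?_
      have ha : (f : Γ(X, ⊤)) ^ N * (mx f y).2 ∈ A := by
        rw [hA]
        exact Set.mem_iUnion.mpr ⟨f, Set.mem_image_of_mem _ hy⟩
      have hu : IsUnit (algebraMap Γ(X, ⊤) Γ(X, X.basicOpen (f : Γ(X, ⊤))) (f : Γ(X, ⊤)) ^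
          ((mx f y).1 + N)) := (IsLocalization.Away.algebraMap_isUnit (f : Γ(X, ⊤))).pow _
      have e : y *
          algebraMap Γ(X, ⊤) Γ(X, X.basicOpen (f : Γ(X, ⊤))) (f : Γ(X, ⊤)) ^ ((mx f y).1 + N) =
            algebraMap Γ(X, ⊤) Γ(X, X.basicOpen (f : Γ(X, ⊤))) ((f : Γ(X, ⊤)) ^ N * (mx f y).2) := by
        rw [pow_add, ← mul_assoc, ← map_pow, hmx f y, map_mul, map_pow]
        ring
      have e' : y =
          algebraMap Γ(X, ⊤) Γ(X, X.basicOpen (f : Γ(X, ⊤))) ((f : Γ(X, ⊤)) ^ N * (mx f y).2) *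
            ↑hu.unit⁻¹ := by
        rw [← e, mul_assoc, IsUnit.mul_val_inv, mul_one]
      show y ∈ Ideal.span (algebraMap Γ(X, ⊤) Γ(X, X.basicOpen (f : Γ(X, ⊤))) '' A)
      rw [e']
      exact Ideal.mul_mem_right _ _ (Ideal.subset_span (Set.mem_image_of_mem _ ha))

end Affine

/-! ## The quasi-separated case (Stacks 01PF for ideals) -/

section QuasiSeparated

/-- The two presentations `U.ι ⁻¹ V → V` (restriction of `U.ι`) and `V.ι ⁻¹ U ↪ V` of the open
`U ∩ V` of the open subscheme `V` have the same range. [folklore] -/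
theorem range_morphismRestrict_ι (U V : X.Opens) :
    Set.range (U.ι ∣_ V) = Set.range (V.ι ⁻¹ᵁ U).ι := by
  ext v
  rw [Scheme.Opens.range_ι]
  constructor
  · rintro ⟨w, rfl⟩
    show V.ι ((U.ι ∣_ V) w) ∈ U
    rw [Scheme.Opens.ι_apply, morphismRestrict_base_coe, Scheme.Opens.ι_apply]
    exact w.1.2
  · intro hv
    have hv' : (v.1 : X) ∈ U := hv
    refine ⟨⟨⟨v.1, hv'⟩, show U.ι ⟨v.1, hv'⟩ ∈ V from v.2⟩, Subtype.ext ?_⟩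
    rw [morphismRestrict_base_coe, Scheme.Opens.ι_apply]

/-- **One step of the induction in Stacks 01PF: extension across an affine open `V`.** In a
quasi-separated scheme `X`, let `U` be a quasi-compact open, `V` an affine open, `𝓕` a sheaf of
ideals and `𝓗` an ideal sheaf with `𝓗|_U ⊆ 𝓕|_U` of finite type. Then there is an ideal sheaf `𝓗₁`
with `𝓗₁|_{U ∪ V} ⊆ 𝓕|_{U ∪ V}` of finite type and `𝓗₁|_U = 𝓗|_U`: extend `𝓗|_{U ∩ V}` to an
ideal sheaf `𝓖_V ⊆ 𝓕|_V` of finite type on the affine scheme `V` (the affine case, `U ∩ V` being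
quasi-compact) and glue, `𝓗₁ = (𝓗|_U)_* ⊓ (𝓖_V)_*`. [cite: StacksProject, Tag 01PF (proof)] -/
theorem exists_extend_sup_affine [QuasiSeparatedSpace X] (U : X.Opens) (hU : IsCompact (U : Set X))
    (V : X.affineOpens) (F H : X.IdealSheafData)
    (hH : ∀ W : X.affineOpens, (W : X.Opens) ≤ U → (H.ideal W).FG)
    (hHF : ∀ W : X.affineOpens, (W : X.Opens) ≤ U → H.ideal W ≤ F.ideal W) :
    ∃ H₁ : X.IdealSheafData,
      (∀ W : X.affineOpens, (W : X.Opens) ≤ U ⊔ V → (H₁.ideal W).FG) ∧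
      (∀ W : X.affineOpens, (W : X.Opens) ≤ U ⊔ V → H₁.ideal W ≤ F.ideal W) ∧
      ∀ W : X.affineOpens, (W : X.Opens) ≤ U → H₁.ideal W = H.ideal W := by
  haveI : IsAffine (V : Scheme.{u}) := V.2
  haveI hqU : QuasiCompact U.ι := quasiCompact_ι_of_isCompact U hU
  haveI hqV : QuasiCompact (V : X.Opens).ι := quasiCompact_ι_of_isCompact _ V.2.isCompact
  -- `U ∩ V` is a quasi-compact open of the affine scheme `V`
  have hUV : IsCompact (((V : X.Opens).ι ⁻¹ᵁ U : (V : Scheme.{u}).Opens) : Set (V : Scheme.{u})) :=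
    (V : X.Opens).ι.isCompact_preimage hU
  -- the affine case on `V`
  have hH' : ∀ W' : (V : Scheme.{u}).affineOpens, (W' : (V : Scheme.{u}).Opens) ≤ (V : X.Opens).ι ⁻¹ᵁ U →
      ((H.comap (V : X.Opens).ι).ideal W').FG := fun W' hW' => by
    rw [ideal_comap_of_isOpenImmersion]
    exact fg_comap_of_bijective _ (ConcreteCategory.bijective_of_isIso ((V : X.Opens).ι.appIso _).inv)
      (hH (imageAffineOpens _ W')
      (((V : X.Opens).ι.image_mono hW').trans ((V : X.Opens).ι.image_preimage_le U)))
  have hHF' : ∀ W' : (V : Scheme.{u}).affineOpens, (W' : (V : Scheme.{u}).Opens) ≤ (V : X.Opens).ι ⁻¹ᵁ U →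
      (H.comap (V : X.Opens).ι).ideal W' ≤ (F.comap (V : X.Opens).ι).ideal W' := fun W' hW' => by
    rw [ideal_comap_of_isOpenImmersion, ideal_comap_of_isOpenImmersion]
    exact Ideal.comap_mono (hHF (imageAffineOpens _ W')
      (((V : X.Opens).ι.image_mono hW').trans ((V : X.Opens).ι.image_preimage_le U)))
  obtain ⟨GV, hGVfg, hGVF, hGVeq⟩ := exists_fg_le_ideal_eq_of_isAffine (X := (V : Scheme.{u}))
    ((V : X.Opens).ι ⁻¹ᵁ U) hUV (F.comap (V : X.Opens).ι) (H.comap (V : X.Opens).ι) hH' hHF'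
  -- `GV` agrees with `H` on `U ∩ V ⊆ V`
  have hGVH : GV.comap ((V : X.Opens).ι ⁻¹ᵁ U).ι = (H.comap (V : X.Opens).ι).comap ((V : X.Opens).ι ⁻¹ᵁ U).ι :=
    comap_ι_eq_of_forall_ideal_eq hGVeq
  -- the glued ideal sheaf `H₁` and its two restrictions
  have e₁ : ((H.comap U.ι).map U.ι ⊓ GV.map (V : X.Opens).ι).comap U.ι = H.comap U.ι := by
    rw [comap_inf_of_isOpenImmersion, comap_map_of_isOpenImmersion, inf_eq_left,
      ← map_morphismRestrict_eq_comap_ι, le_map_iff_comap_le, ← Scheme.IdealSheafData.comap_comp,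
      morphismRestrict_ι, Scheme.IdealSheafData.comap_comp, hGVH]
  have e₂ : ((H.comap U.ι).map U.ι ⊓ GV.map (V : X.Opens).ι).comap (V : X.Opens).ι = GV := by
    rw [comap_inf_of_isOpenImmersion, comap_map_of_isOpenImmersion, inf_eq_right,
      ← map_morphismRestrict_eq_comap_ι, le_map_iff_comap_le, ← Scheme.IdealSheafData.comap_comp]
    -- compare the two presentations of `U ∩ V` over `V`
    let θ := IsOpenImmersion.isoOfRangeEq (U.ι ∣_ (V : X.Opens)) (((V : X.Opens).ι ⁻¹ᵁ U).ι)
      (range_morphismRestrict_ι U V)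
    have hθ : U.ι ∣_ (V : X.Opens) = θ.hom ≫ ((V : X.Opens).ι ⁻¹ᵁ U).ι :=
      (IsOpenImmersion.isoOfRangeEq_hom_fac _ _ _).symm
    have key : GV.comap (U.ι ∣_ (V : X.Opens)) = H.comap ((U.ι ∣_ (V : X.Opens)) ≫ (V : X.Opens).ι) := by
      rw [hθ, Scheme.IdealSheafData.comap_comp, hGVH, ← Scheme.IdealSheafData.comap_comp,
        ← Scheme.IdealSheafData.comap_comp, Category.assoc]
    rw [key, morphismRestrict_ι]
  refine ⟨(H.comap U.ι).map U.ι ⊓ GV.map (V : X.Opens).ι, ?_, ?_, fun W hW => ?_⟩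
  · -- of finite type on `U ∪ V`
    intro W hW
    refine fg_ideal_of_le_iSup _ (fun b : Bool => cond b U (V : X.Opens)) (fun b W' hW' => ?_) W
      (by rwa [iSup_bool_eq])
    cases b with
    | true =>
      rw [ideal_eq_of_comap_ι_eq e₁ W' hW']
      exact hH W' hW'
    | false =>
      exact fg_ideal_of_fg_ideal_comap_ι (U := (V : X.Opens)) (fun W'' => by rw [e₂]; exact hGVfg W'')
        W' hW'
  · -- contained in `F` on `U ∪ V`
    intro W hW
    refine ideal_le_ideal_of_le_iSup _ _ (fun b : Bool => cond b U (V : X.Opens)) (fun b W' hW' => ?_) W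
      (by rwa [iSup_bool_eq])
    cases b with
    | true =>
      rw [ideal_eq_of_comap_ι_eq e₁ W' hW']
      exact hHF W' hW'
    | false =>
      exact ideal_le_of_comap_ι_le (U := (V : X.Opens)) (by rw [e₂]; exact hGVF) W' hW'
  · -- equal to `H` on `U`
    exact ideal_eq_of_comap_ι_eq e₁ W hW

/-- A quasi-compact scheme has a finite set of affine opens covering it. [folklore] -/
theorem exists_finset_affineOpens_iSup_eq_top (X : Scheme.{u}) [CompactSpace X] :
    ∃ t : Finset X.affineOpens, (⊤ : X.Opens) ≤ ⨆ V ∈ t, (V : X.Opens) := by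
  classical
  let 𝒰 := X.affineCover.finiteSubcover
  let g : 𝒰.I₀ → X.affineOpens := fun i => ⟨(𝒰.f i).opensRange, isAffineOpen_opensRange (𝒰.f i)⟩
  refine ⟨Finset.univ.image g, ?_⟩
  rw [← 𝒰.iSup_opensRange]
  exact iSup_le fun i => le_iSup₂_of_le (g i) (Finset.mem_image_of_mem g (Finset.mem_univ i)) le_rfl

/-- **Stacks 01PF for sheaves of ideals (extension from a quasi-compact open of a quasi-compact
quasi-separated scheme).** Let `X` be quasi-compact and quasi-separated, `U ⊆ X` a quasi-compact
open, `𝓕` a quasi-coherent sheaf of ideals on `X` and `𝓗` an ideal sheaf whose section ideals on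
the affine opens `W ⊆ U` are finitely generated and contained in those of `𝓕`. Then there is an
ideal sheaf `𝓖 ⊆ 𝓕` of finite type on `X` with the same section ideals as `𝓗` on every affine
open `W ⊆ U`. Stacks: "Let `X` be a quasi-compact and quasi-separated scheme. Let `U ⊂ X` be a
quasi-compact open. Let `𝓕` be a quasi-coherent `𝒪_X`-module. Let `𝓖 ⊂ 𝓕|_U` be a
quasi-coherent `𝒪_U`-submodule which is of finite type. Then there exists a quasi-coherent
submodule `𝓖' ⊂ 𝓕` which is of finite type such that `𝓖'|_U = 𝓖`", here for `𝓕` a sheaf of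
ideals. Proof as printed: induction on the number of affine opens in a finite affine open cover
of `X`, by `exists_extend_sup_affine`. [cite: StacksProject, Tag 01PF] -/
theorem exists_fg_le_ideal_eq [CompactSpace X] [QuasiSeparatedSpace X] (U : X.Opens)
    (hU : IsCompact (U : Set X)) (F H : X.IdealSheafData)
    (hH : ∀ W : X.affineOpens, (W : X.Opens) ≤ U → (H.ideal W).FG)
    (hHF : ∀ W : X.affineOpens, (W : X.Opens) ≤ U → H.ideal W ≤ F.ideal W) :
    ∃ G : X.IdealSheafData, (∀ W : X.affineOpens, (G.ideal W).FG) ∧ G ≤ F ∧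
      ∀ W : X.affineOpens, (W : X.Opens) ≤ U → G.ideal W = H.ideal W := by
  classical
  obtain ⟨t, ht⟩ := exists_finset_affineOpens_iSup_eq_top X
  suffices key : ∀ (t : Finset X.affineOpens) (U : X.Opens) (_ : IsCompact (U : Set X))
      (H : X.IdealSheafData), (∀ W : X.affineOpens, (W : X.Opens) ≤ U → (H.ideal W).FG) →
      (∀ W : X.affineOpens, (W : X.Opens) ≤ U → H.ideal W ≤ F.ideal W) →
      (⊤ : X.Opens) ≤ U ⊔ ⨆ V ∈ t, (V : X.Opens) →
      ∃ G : X.IdealSheafData, (∀ W : X.affineOpens, (G.ideal W).FG) ∧ G ≤ F ∧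
        ∀ W : X.affineOpens, (W : X.Opens) ≤ U → G.ideal W = H.ideal W from
    key t U hU H hH hHF (ht.trans le_sup_right)
  intro t
  induction t using Finset.induction_on with
  | empty =>
    intro U _ H hH hHF htop
    have hWU : ∀ W : X.affineOpens, (W : X.Opens) ≤ U := fun W =>
      le_top.trans (htop.trans (by simp))
    exact ⟨H, fun W => hH W (hWU W), fun W => hHF W (hWU W), fun W _ => rfl⟩
  | insert V t _ ih =>
    intro U hU H hH hHF htop
    obtain ⟨H₁, h₁fg, h₁F, h₁eq⟩ := exists_extend_sup_affine U hU V F H hH hHF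
    have hU₁ : IsCompact ((U ⊔ (V : X.Opens) : X.Opens) : Set X) := by
      rw [Opens.coe_sup]
      exact hU.union V.2.isCompact
    obtain ⟨G, hGfg, hGF, hGeq⟩ := ih (U ⊔ V) hU₁ H₁ h₁fg h₁F
      (by rwa [Finset.iSup_insert, ← sup_assoc] at htop)
    exact ⟨G, hGfg, hGF, fun W hW => (hGeq W (hW.trans le_sup_left)).trans (h₁eq W hW)⟩

/-- The same in terms of restrictions: for `𝓗'` an ideal sheaf of finite type on the open
subscheme `U` contained in `𝓕|_U`, there is an ideal sheaf `𝓖 ⊆ 𝓕` of finite type on `X` with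
`𝓖|_U = 𝓗'`. [cite: StacksProject, Tag 01PF] -/
theorem exists_fg_le_comap_ι_eq [CompactSpace X] [QuasiSeparatedSpace X] (U : X.Opens)
    (hU : IsCompact (U : Set X)) (F : X.IdealSheafData) (H' : (U : Scheme.{u}).IdealSheafData)
    (hH' : ∀ W' : (U : Scheme.{u}).affineOpens, (H'.ideal W').FG) (hHF : H' ≤ F.comap U.ι) :
    ∃ G : X.IdealSheafData, (∀ W : X.affineOpens, (G.ideal W).FG) ∧ G ≤ F ∧ G.comap U.ι = H' := by
  haveI : QuasiCompact U.ι := quasiCompact_ι_of_isCompact U hU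
  have e : (H'.map U.ι).comap U.ι = H' := comap_map_of_isOpenImmersion U.ι H'
  obtain ⟨G, hGfg, hGF, hGeq⟩ := exists_fg_le_ideal_eq U hU F (H'.map U.ι)
    (fg_ideal_of_fg_ideal_comap_ι (fun W' => by rw [e]; exact hH' W'))
    (ideal_le_of_comap_ι_le (by rw [e]; exact hHF))
  exact ⟨G, hGfg, hGF, (comap_ι_eq_of_forall_ideal_eq hGeq).trans e⟩

end QuasiSeparated

/-! ## Ideal sheaves on qcqs schemes are directed unions of ideal sheaves of finite type
(Stacks 01PG for ideals) -/

section Colimit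

/-- The sub-ideal-sheaves of finite type of an ideal sheaf. [folklore] -/
def fgBelow (I : X.IdealSheafData) : Set X.IdealSheafData :=
  {J | (∀ W : X.affineOpens, (J.ideal W).FG) ∧ J ≤ I}

/-- Membership in `fgBelow I`. [folklore] -/
theorem mem_fgBelow_iff {I J : X.IdealSheafData} :
    J ∈ fgBelow I ↔ (∀ W : X.affineOpens, (J.ideal W).FG) ∧ J ≤ I :=
  Iff.rfl

/-- `⊥ ∈ fgBelow I`. [folklore] -/
theorem bot_mem_fgBelow (I : X.IdealSheafData) : ⊥ ∈ fgBelow I :=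
  ⟨fun W => by rw [ideal_bot]; exact Submodule.fg_bot, bot_le⟩

/-- `fgBelow I` is directed: the supremum of two ideal sheaves of finite type is of finite type
(`(J ⊔ J')(W) = J(W) + J'(W)`). [folklore] -/
theorem directedOn_fgBelow (I : X.IdealSheafData) : DirectedOn (· ≤ ·) (fgBelow I) := by
  rintro J ⟨hJ, hJI⟩ J' ⟨hJ', hJ'I⟩
  refine ⟨J ⊔ J', ⟨fun W => ?_, sup_le hJI hJ'I⟩, le_sup_left, le_sup_right⟩
  rw [ideal_sup]
  exact Submodule.FG.sup (hJ W) (hJ' W)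

/-- **Every section of `𝓘` over an affine open lies in a sub-ideal-sheaf of finite type** (on a
quasi-compact quasi-separated scheme): the ideal sheaf of finite type generated by `x ∈ 𝓘(W)` on
the affine scheme `W` extends to one on `X` inside `𝓘` (`exists_fg_le_comap_ι_eq`).
[cite: StacksProject, Tag 01PG (proof)] -/
theorem exists_mem_fgBelow_mem_ideal [CompactSpace X] [QuasiSeparatedSpace X] (I : X.IdealSheafData)
    (W : X.affineOpens) {x : Γ(X, W)} (hx : x ∈ I.ideal W) :
    ∃ G ∈ fgBelow I, x ∈ G.ideal W := by
  haveI : IsAffine (W : Scheme.{u}) := W.2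
  -- transport `x` to a global section `x'` of the affine scheme `W`
  have hA : (W : X.Opens).ι ''ᵁ ⊤ = W := by
    rw [Scheme.Hom.image_top_eq_opensRange, Scheme.Opens.opensRange_ι]
  have hAaff : IsAffineOpen ((W : X.Opens).ι ''ᵁ ⊤) :=
    (isAffineOpen_top (W : Scheme.{u})).image_of_isOpenImmersion _
  obtain ⟨x₁, hx₁⟩ : ∃ x₁ : Γ(X, (W : X.Opens).ι ''ᵁ ⊤),
      x₁ = (X.presheaf.map (eqToHom hA).op).hom x := ⟨_, rfl⟩
  have hx₁I : x₁ ∈ I.ideal ⟨(W : X.Opens).ι ''ᵁ ⊤, hAaff⟩ := by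
    rw [← I.map_ideal' (U := ⟨(W : X.Opens).ι ''ᵁ ⊤, hAaff⟩) (V := W) (eqToHom hA).op, hx₁]
    exact Ideal.mem_map_of_mem _ hx
  obtain ⟨x', hx'⟩ : ∃ x' : Γ((W : Scheme.{u}), ⊤), x' = ((W : X.Opens).ι.appIso ⊤).hom x₁ :=
    ⟨_, rfl⟩
  have hx'x : ((W : X.Opens).ι.appIso ⊤).inv.hom x' = x₁ := by
    rw [hx', ← CommRingCat.comp_apply, Iso.hom_inv_id, CommRingCat.id_apply]
  -- the ideal sheaf of finite type generated by `x'` on `W`, contained in `I|_W`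
  have hfg : (Ideal.span {x'} : Ideal Γ((W : Scheme.{u}), ⊤)).FG := ⟨{x'}, by simp⟩
  have hKfg : ∀ W' : (W : Scheme.{u}).affineOpens,
      ((ofIdealTop (Ideal.span {x'}) : (W : Scheme.{u}).IdealSheafData).ideal W').FG := fun W' => by
    rw [ofIdealTop_ideal]
    exact hfg.map _
  have hKI : (ofIdealTop (Ideal.span {x'}) : (W : Scheme.{u}).IdealSheafData) ≤
      I.comap (W : X.Opens).ι := by
    refine le_of_isAffine ?_
    rw [ofIdealTop_ideal, Ideal.map_le_iff_le_comap, Ideal.span_le, Set.singleton_subset_iff,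
      SetLike.mem_coe, Ideal.mem_comap]
    have e : (homOfLE (le_top : (⊤ : (W : Scheme.{u}).Opens) ≤ ⊤)).op = 𝟙 _ :=
      Subsingleton.elim _ _
    rw [e, (W : Scheme.{u}).presheaf.map_id, CommRingCat.hom_id, RingHom.id_apply,
      ideal_comap_of_isOpenImmersion, Ideal.mem_comap, hx'x]
    exact hx₁I
  obtain ⟨G, hGfg, hGI, hGK⟩ := exists_fg_le_comap_ι_eq (W : X.Opens) W.2.isCompact I
    (ofIdealTop (Ideal.span {x'})) hKfg hKI
  refine ⟨G, ⟨hGfg, hGI⟩, ?_⟩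
  -- `x' ∈ K(W) = G|_W(W)`, i.e. `x ∈ G(W)`
  have h1 : x' ∈ (G.comap (W : X.Opens).ι).ideal ⟨⊤, isAffineOpen_top _⟩ := by
    have e : (homOfLE (le_top : (⊤ : (W : Scheme.{u}).Opens) ≤ ⊤)).op = 𝟙 _ :=
      Subsingleton.elim _ _
    rw [hGK, ofIdealTop_ideal, e, (W : Scheme.{u}).presheaf.map_id, CommRingCat.hom_id, Ideal.map_id]
    exact Ideal.subset_span rfl
  rw [ideal_comap_of_isOpenImmersion, Ideal.mem_comap, hx'x] at h1
  -- `h1 : x₁ ∈ G(W.ι(⊤))`; transport back to `W`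
  have h2 := Ideal.mem_map_of_mem (X.presheaf.map (eqToHom hA.symm).op).hom h1
  rw [G.map_ideal' (U := W) (V := ⟨(W : X.Opens).ι ''ᵁ ⊤, hAaff⟩) (eqToHom hA.symm).op] at h2
  have h3 : (X.presheaf.map (eqToHom hA.symm).op).hom x₁ = x := by
    rw [hx₁, ← CommRingCat.comp_apply, ← X.presheaf.map_comp, ← op_comp, eqToHom_trans, eqToHom_refl,
      op_id, X.presheaf.map_id, CommRingCat.id_apply]
  rw [h3] at h2
  exact h2

/-- **Stacks 01PG for sheaves of ideals**: on a quasi-compact and quasi-separated scheme every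
quasi-coherent sheaf of ideals is the union of its sub-ideal-sheaves of finite type (a directed
family, `directedOn_fgBelow`). Stacks 01PG: every quasi-coherent module on a quasi-compact and
quasi-separated scheme is the directed colimit of its finite type quasi-coherent submodules;
here the ideal-sheaf form `𝓘 = ⋃ {𝓙 ⊆ 𝓘 of finite type}`. [cite: StacksProject, Tag 01PG] -/
theorem eq_sSup_fgBelow [CompactSpace X] [QuasiSeparatedSpace X] (I : X.IdealSheafData) :
    I = sSup (fgBelow I) := by
  refine le_antisymm (fun W x hx => ?_) (sSup_le fun J hJ => hJ.2)
  obtain ⟨G, hG, hxG⟩ := exists_mem_fgBelow_mem_ideal I W hx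
  exact (ideal_mono (le_sSup hG) W) hxG

/-- **An ideal sheaf of finite type on a quasi-compact scheme is a compact element**: if it lies
below the supremum of a nonempty directed family of ideal sheaves, it lies below a member (on
each of finitely many affine opens, finitely many generators lie in a common member, the section
ideals of a directed supremum being the directed union of the section ideals). [folklore] -/
theorem exists_le_of_fg_of_le_sSup [CompactSpace X] (K : X.IdealSheafData)
    (hK : ∀ W : X.affineOpens, (K.ideal W).FG) {S : Set X.IdealSheafData} (hS : S.Nonempty)
    (hdir : DirectedOn (· ≤ ·) S) (hle : K ≤ sSup S) : ∃ J ∈ S, K ≤ J := by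
  classical
  haveI : Nonempty S := hS.to_subtype
  have hdv : Directed (· ≤ ·) (Subtype.val : S → X.IdealSheafData) := hdir.directed_val
  -- on one affine open
  have hone : ∀ W : X.affineOpens, ∃ J : S, K.ideal W ≤ (J : X.IdealSheafData).ideal W := fun W => by
    have hdW : Directed (· ≤ ·) (fun J : S => (J : X.IdealSheafData).ideal W) :=
      hdv.mono_comp _ (fun a b h => ideal_mono h W)
    obtain ⟨s, hs⟩ := hK W
    have hgen : ∀ y ∈ s, ∃ J : S, y ∈ (J : X.IdealSheafData).ideal W := fun y hy => by
      have hy' : y ∈ (sSup S).ideal W := hle W (hs ▸ Ideal.subset_span hy)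
      rw [sSup_eq_iSup', ideal_iSup, iSup_apply, Submodule.mem_iSup_of_directed _ hdW] at hy'
      exact hy'
    choose! J hJ using hgen
    obtain ⟨z, hz⟩ := hdv.finset_le (s.image J)
    refine ⟨z, ?_⟩
    rw [← hs]
    refine Ideal.span_le.mpr fun y hy => ?_
    exact (hz (J y) (Finset.mem_image_of_mem J hy)) W (hJ y hy)
  choose J hJ using hone
  obtain ⟨t, ht⟩ := exists_finset_affineOpens_iSup_eq_top X
  obtain ⟨z, hz⟩ := hdv.finset_le (t.image J)
  have ht' : ⨆ V : t, ((V : X.affineOpens) : X.Opens) = ⊤ := by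
    refine top_le_iff.mp (ht.trans (le_of_eq ?_))
    exact iSup_subtype'
  refine ⟨z, z.2, Scheme.IdealSheafData.le_of_iSup_eq_top (fun V : t => (V : X.affineOpens)) ht'
    fun V => ?_⟩
  exact (hJ V).trans ((hz (J V) (Finset.mem_image_of_mem J V.2)) V)

/-- In particular (with `eq_sSup_fgBelow`): an ideal sheaf of finite type below `𝓘` on a
quasi-compact scheme is below a member of any nonempty directed family with supremum `𝓘`.
[folklore] -/
theorem exists_le_of_fg_of_eq_sSup [CompactSpace X] (K I : X.IdealSheafData)
    (hK : ∀ W : X.affineOpens, (K.ideal W).FG) (hKI : K ≤ I) {S : Set X.IdealSheafData}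
    (hS : S.Nonempty) (hdir : DirectedOn (· ≤ ·) S) (hI : I = sSup S) : ∃ J ∈ S, K ≤ J :=
  exists_le_of_fg_of_le_sSup K hK hS hdir (hKI.trans hI.le)

end Colimit

end Literature.AlgebraicGeometry.Limits
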